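import Summits.QuantumFields.QCD.Theorems.QuarksAsStableActionStableActionBridgeFermionSliceCovariance
import Summits.QuantumFields.QCD.Theorems.QuarksAsStableActionStableActionBridgeSliceGaugeUnitarity
import Summits.QuantumFields.QCD.Theorems.QuarksAsStableActionStableActionBridgeFermionSliceOpCovariance
import Summits.QuantumFields.QCD.Theorems.QuarksAsStableActionStableActionBridgeFermionSliceContinuous

/-!
# The fermionic transfer operator `T̂_F` preserves the form core
(helper for crux stmt-QuantumFields-9737 `QuarksAsStableAction.StableActionBridge`, line `Sketch`;
registered stubs `fermionSliceOp_mulVec_mem_transferCore` and `fermionSliceOp_gaugeTransform`)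

Smit (*Introduction to Quantum Fields on a Lattice*, §6.5 (6.87)) writes the transfer operator of
lattice QCD with `r = 1` Wilson quarks as `T̂ = T̂_F^{1/2} T̂_U T̂_F^{1/2} P̂₀`, and the tree renders
its Rayleigh quotient at the vector `T̂_F^{1/2} Ψ` on the **form core** `transferCore Nf S` of
continuous, gauge-invariant Fock-vector-valued wave functions `Ψ : SU(3)^{Edge 3 S} → Fock`
(`Ψ(U^g) = Γ(G_g) Ψ(U)`, the range of the Gauss-law projector `P̂₀`, Smit §4.6 (4.127)).  This file
proves that the fibrewise action `Ψ ↦ (U ↦ T̂_F(U) Ψ(U))` of the fermionic transfer operator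
`T̂_F(U) = fermionSliceOp U mq` maps the core to itself whenever all bare masses satisfy `m_f > −1`:

* continuity: `U ↦ T̂_F(U)` is continuous for `m_f > −1` (landed `continuous_fermionSliceOp`), and
  `Continuous.matrix_mulVec`;
* gauge invariance: the unconditional covariance `T̂_F(U^g) = Γ(G_g) T̂_F(U) Γ(G_g)ᴴ`
  (`fermionSliceOp_gaugeTransform'`, discharging the two hypotheses of the landed
  `fermionSliceOp_gaugeTransform_of` by the landed `fermionSliceMatrix_gaugeTransform` and
  `det_sliceMassHop_gaugeTransform`) and unitarity `Γ(G_g)ᴴ Γ(G_g) = 1`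
  (`fockGaugeAct_conjTranspose_mul_self`) give the intertwining
  `T̂_F(U^g) (Γ(G_g) v) = Γ(G_g) (T̂_F(U) v)` (`fermionSliceOp_gaugeTransform_mulVec`), whence
  `T̂_F(U^g) Ψ(U^g) = T̂_F(U^g) Γ(G_g) Ψ(U) = Γ(G_g) (T̂_F(U) Ψ(U))`.

We also record the registered operator form of the intertwining,
`T̂_F(U^g) Γ(G_g) = Γ(G_g) T̂_F(U)` (`fermionSliceOp_gaugeTransform`).  Pure theorem file
(no definitions).

[cite: Smit2023, §4.6 (4.127) and §6.5 (6.87)]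
-/

noncomputable section

namespace Summit.QuantumFields.QCD.Cruxes.StableActionBridge.Sketch

open MeasureTheory Matrix Literature.MathematicalPhysics.QuantumFieldTheory
  Literature.MathematicalPhysics.QuantumLattice
open Literature.Probability.LatticeModels (TorusSite)

/-- **Gauge covariance of the fermionic transfer operator** (unconditional form of the landed
`fermionSliceOp_gaugeTransform_of`): `T̂_F(U^g) = Γ(G_g) T̂_F(U) Γ(G_g)ᴴ` for every
time-independent gauge transformation `g`, every background `U` and all bare masses, with
`Γ(G_g) = fockGaugeAct g` the second-quantised gauge rotation of the slice quark modes.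
[cite: Smit2023, §6.5 (6.91) and §4.6 (4.127)] -/
theorem fermionSliceOp_gaugeTransform' {Nf S : ℕ} [NeZero S]
    (g : TorusSite 3 S → Matrix.specialUnitaryGroup (Fin 3) ℂ)
    (U : GaugeConfig 3 S (Matrix.specialUnitaryGroup (Fin 3) ℂ)) (mq : Fin Nf → ℝ) :
    fermionSliceOp (gaugeTransform g U) mq =
      fockGaugeAct g * fermionSliceOp (Nf := Nf) U mq * (fockGaugeAct g)ᴴ :=
  fermionSliceOp_gaugeTransform_of Nf S g U mq (fermionSliceMatrix_gaugeTransform Nf S g U mq)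
    (det_sliceMassHop_gaugeTransform Nf S g U mq)

/-- The Fock-space gauge action is an isometry on vectors: `Γ(G_g)ᴴ (Γ(G_g) v) = v`.
[cite: Smit2023, §4.6 (4.125)–(4.127)] -/
theorem fockGaugeAct_conjTranspose_mulVec_mulVec {Nf S : ℕ} [NeZero S]
    (g : TorusSite 3 S → Matrix.specialUnitaryGroup (Fin 3) ℂ)
    (v : Fock (SliceFermiIdx Nf S)) :
    (fockGaugeAct (Nf := Nf) (S := S) g)ᴴ *ᵥ (fockGaugeAct g *ᵥ v) = v := by
  rw [Matrix.mulVec_mulVec, (fockGaugeAct_conjTranspose_mul_self Nf S g).1, Matrix.one_mulVec]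

/-- **The fermionic transfer operator intertwines the gauge action on Fock vectors**:
`T̂_F(U^g) (Γ(G_g) v) = Γ(G_g) (T̂_F(U) v)` (covariance `T̂_F(U^g) = Γ T̂_F(U) Γᴴ` and
`Γᴴ Γ = 1`). [cite: Smit2023, §6.5 (6.87), (6.91) and §4.6 (4.127)] -/
theorem fermionSliceOp_gaugeTransform_mulVec {Nf S : ℕ} [NeZero S]
    (g : TorusSite 3 S → Matrix.specialUnitaryGroup (Fin 3) ℂ)
    (U : GaugeConfig 3 S (Matrix.specialUnitaryGroup (Fin 3) ℂ)) (mq : Fin Nf → ℝ)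
    (v : Fock (SliceFermiIdx Nf S)) :
    fermionSliceOp (gaugeTransform g U) mq *ᵥ (fockGaugeAct g *ᵥ v) =
      fockGaugeAct g *ᵥ (fermionSliceOp (Nf := Nf) U mq *ᵥ v) := by
  rw [fermionSliceOp_gaugeTransform' g U mq]
  simp only [← Matrix.mulVec_mulVec, fockGaugeAct_conjTranspose_mulVec_mulVec]

/-- **Stub `fermionSliceOp_gaugeTransform` of line `Sketch`: the fermionic transfer operator
commutes with the gauge action**, in the operator form `T̂_F(U^g) Γ(G_g) = Γ(G_g) T̂_F(U)`
(from `T̂_F(U^g) = Γ T̂_F(U) Γᴴ` and `Γᴴ Γ = 1`; the mass hypothesis is not used).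
[cite: Smit2023, §6.5 (6.87), (6.91) and §4.6 (4.127)] -/
theorem fermionSliceOp_gaugeTransform : ∀ (Nf S : ℕ) [NeZero S] (g : TorusSite 3 S → Matrix.specialUnitaryGroup (Fin 3) ℂ) (U : GaugeConfig 3 S (Matrix.specialUnitaryGroup (Fin 3) ℂ)) (mq : Fin Nf → ℝ), (∀ f, -1 < mq f) → fermionSliceOp (gaugeTransform g U) mq * fockGaugeAct g = fockGaugeAct (Nf := Nf) g * fermionSliceOp U mq := by
  intro Nf S _ g U mq _
  rw [fermionSliceOp_gaugeTransform' g U mq, Matrix.mul_assoc,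
    (fockGaugeAct_conjTranspose_mul_self Nf S g).1, Matrix.mul_one]

/-- **Stub `fermionSliceOp_mulVec_mem_transferCore` of line `Sketch`: `T̂_F` preserves the form
core** (Smit §6.5 (6.87)).  For all bare masses `m_f > −1` and every continuous gauge-invariant
wave function `Ψ`, the wave function `U ↦ T̂_F(U) Ψ(U)` is again continuous
(`continuous_fermionSliceOp`) and gauge invariant:
`T̂_F(U^g) Ψ(U^g) = T̂_F(U^g) Γ(G_g) Ψ(U) = Γ(G_g) (T̂_F(U) Ψ(U))`.
[cite: Smit2023, §4.6 (4.127) and §6.5 (6.87)] -/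
theorem fermionSliceOp_mulVec_mem_transferCore : ∀ (Nf S : ℕ) [NeZero S] (mq : Fin Nf → ℝ), (∀ f, -1 < mq f) → ∀ Ψ : SliceWave Nf S, Ψ ∈ transferCore Nf S → (fun U : GaugeConfig 3 S (Matrix.specialUnitaryGroup (Fin 3) ℂ) => fermionSliceOp U mq *ᵥ Ψ U) ∈ transferCore Nf S := by
  intro Nf S _ mq hm Ψ hΨ
  obtain ⟨hcont, hinv⟩ := hΨ
  refine ⟨(continuous_fermionSliceOp Nf S mq hm).matrix_mulVec hcont, fun g U => ?_⟩
  show fermionSliceOp (gaugeTransform g U) mq *ᵥ Ψ (gaugeTransform g U) =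
    fockGaugeAct g *ᵥ (fermionSliceOp U mq *ᵥ Ψ U)
  rw [hinv g U, fermionSliceOp_gaugeTransform_mulVec]

end Summit.QuantumFields.QCD.Cruxes.StableActionBridge.Sketch

end
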